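import Literature.NumberTheory.LFunctions.TatuzawaTheorem
import HarnessLib

/-!
# Real zeros of quadratic Dirichlet `L`-functions: `β ≤ 1 − c(ε) q^{-ε}` with an EXPLICIT constant and at
# most ONE exceptional modulus (Tatuzawa's form of Montgomery–Vaughan Cor. 11.15)

Topic `Literature/NumberTheory/LFunctions`, namespace `Literature.NumberTheory.LFunctions.Siegel`.
Theorem-only file (no definition, no named fact); everything PROVED.

Montgomery–Vaughan, *Multiplicative Number Theory I*, Corollary 11.15: for every `ε > 0` there is
`C(ε) > 0` such that every real zero `β` of `L(s, χ)`, `χ` quadratic mod `q`, has `β < 1 − C(ε)q^{-ε}`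
(tree: `Siegel.exists_one_sub_realZero_ge`, INEFFECTIVE, from Siegel's theorem).  Feeding instead
Tatuzawa's theorem with the tree's explicit constant (`Siegel.tatuzawa_atMostOne_modulus`,
`TatuzawaTheorem.lean`: `Re L(1,χ) ≥ C_T ε³ q^{-ε}`, `C_T = c_E/(2592 B)`, for all primitive quadratic `χ`
except those of one modulus `q₀(ε)`) into the mean-value bound
`L(1,χ) ≤ (1 − β)·2q^{4r}Z_r/r` (`Siegel.norm_LFunction_one_le_of_realZero`) gives the same statement with
an EXPLICIT constant and one exceptional modulus:

* `one_sub_realZero_ge_of_LFunction_one_ge` — if `Re L(1,χ) ≥ C_T ε'³ q^{-ε'}` (`ε' = 4ε/5`) then every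
  real zero `β` of `L(s,χ)` has `1 − β ≥ (C_T ε⁵/1000)·q^{-ε}`;
* `tatuzawa_realZero_atMostOne_modulus` — **for `0 < ε ≤ 1` there is `q₀ = q₀(ε)` such that
  `1 − β ≥ (C_T ε⁵/1000)·q^{-ε}` for every `q ≠ q₀`, every primitive quadratic `χ mod q` and every real
  zero `β` of `L(s, χ)`** (explicit constant; `q₀` chosen classically);
* `tatuzawa_realZero_of_ne` — of two primitive quadratic characters with different moduli, at least
  one has all its real zeros `β` with `1 − β ≥ (C_T ε⁵/1000)·q^{-ε}`.

References: [Tatuzawa1951, Theorem 2 and Lemma 7]; [MontgomeryVaughan2007, §11.2 Corollary 11.15 and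
Exercise 6]; [Siegel1935].
-/

noncomputable section

open Complex Filter Topology Metric Set

namespace Literature.NumberTheory.LFunctions.Siegel

open DirichletAbel SiegelCoefficients Estermann DirichletZFR

/-- `c_E ≤ 1/2` (`c_E = ½·exp(−(1/4 + log 528/(4 log(6/5))))`). [folklore] -/
private lemma estermannC_le_half' : estermannC ≤ 1 / 2 := by
  unfold estermannC
  have h1 : 0 < Real.log 528 := Real.log_pos (by norm_num)
  have h2 : 0 < Real.log (6 / 5) := Real.log_pos (by norm_num)
  have h3 : Real.exp (-(1 / 4 + Real.log 528 / (4 * Real.log (6 / 5)))) ≤ 1 := by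
    rw [Real.exp_le_one_iff]
    have : 0 < Real.log 528 / (4 * Real.log (6 / 5)) := by positivity
    linarith
  linarith

/-- **From Tatuzawa's bound at `s = 1` to the real zeros** (the step MV use for Cor. 11.15, with explicit
constants): let `χ ≠ χ₀` mod `q` be quadratic, `0 < ε ≤ 1`, `ε' = 4ε/5`, and suppose
`Re L(1, χ) ≥ C_T ε'³ q^{-ε'}`.  Then every real zero `β` of `L(s, χ)` satisfies
`(C_T ε⁵/1000)·q^{-ε} ≤ 1 − β` (`C_T = c_E/(2592 B)`): either `1 − β ≥ ε/20`, or the mean-value bound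
`L(1,χ) ≤ (1−β)·288 q^{ε'/4}/ε'²` applies. [cite: MontgomeryVaughan2007, §11.2 Corollary 11.15 (proof)]
[cite: Tatuzawa1951, Lemma 7] -/
theorem one_sub_realZero_ge_of_LFunction_one_ge {ε : ℝ} (hε : 0 < ε) (hε1 : ε ≤ 1) {q : ℕ} [NeZero q]
    (χ : DirichletCharacter ℂ q) (hχ : χ ≠ 1)
    (hL : estermannC / (2592 * ballConst) * (4 * ε / 5) ^ 3 * (q : ℝ) ^ (-(4 * ε / 5)) ≤
      (χ.LFunction 1).re)
    {β : ℝ} (hzero : χ.LFunction β = 0) :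
    estermannC / (2592 * ballConst) * ε ^ 5 / 1000 * (q : ℝ) ^ (-ε) ≤ 1 - β := by
  have hc := estermannC_pos
  have hB1 := one_le_ballConst
  have hCT0 : 0 < estermannC / (2592 * ballConst) := by positivity
  have hCT1 : estermannC / (2592 * ballConst) ≤ 1 := by
    rw [div_le_one (by positivity)]; nlinarith [estermannC_le_half']
  set CT : ℝ := estermannC / (2592 * ballConst) with hCTdef
  have hq0 : (0 : ℝ) < q := by exact_mod_cast NeZero.pos q
  have hq1 : (1 : ℝ) ≤ q := by exact_mod_cast NeZero.one_le
  have hqε1 : (q : ℝ) ^ (-ε) ≤ 1 := Real.rpow_le_one_of_one_le_of_nonpos hq1 (by linarith)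
  have hqε0 : 0 < (q : ℝ) ^ (-ε) := Real.rpow_pos_of_pos hq0 _
  have hε4 : ε ^ 4 ≤ 1 := by
    have : ε ^ 4 ≤ 1 ^ 4 := pow_le_pow_left₀ hε.le hε1 4
    simpa using this
  -- `β < 1`
  have hβ1 : β < 1 := by
    by_contra hcon
    exact DirichletCharacter.LFunction_ne_zero_of_one_le_re χ (Or.inl hχ) (s := β)
      (by simp; linarith) hzero
  set ε' : ℝ := 4 * ε / 5 with hε'def
  have hε'0 : 0 < ε' := by positivity
  have hε'1 : ε' ≤ 1 := by rw [hε'def]; linarith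
  set r : ℝ := ε' / 16 with hrdef
  have hr : 0 < r := by positivity
  have hr1 : r ≤ 1 / 8 := by rw [hrdef]; linarith
  have hrε : r = ε / 20 := by rw [hrdef, hε'def]; ring
  -- the small constant is at most `ε/20 · q^{-ε} ≤ ε/20`
  have hsmall : CT * ε ^ 5 / 1000 * (q : ℝ) ^ (-ε) ≤ ε / 20 := by
    have h1 : CT * ε ^ 5 / 1000 * (q : ℝ) ^ (-ε) ≤ CT * ε ^ 5 / 1000 * 1 :=
      mul_le_mul_of_nonneg_left hqε1 (by positivity)
    have h2 : CT * ε ^ 5 / 1000 ≤ ε / 20 := by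
      rw [div_le_div_iff₀ (by norm_num) (by norm_num)]
      have : CT * ε ^ 4 ≤ 1 := by nlinarith
      nlinarith
    linarith
  rcases le_or_gt β (1 - r) with hfar | hnear
  · -- far zero: `1 − β ≥ r = ε/20`
    rw [hrε] at hfar; linarith
  · -- near zero: mean value bound
    have hmv := norm_LFunction_one_le_of_realZero χ hχ hr hr1 hnear.le hzero
    set Z : ℝ := ∑' m : ℕ, ((m + 1 : ℕ) : ℝ) ^ (-(1 + 2 * r)) with hZdef
    have hZ0 : 0 ≤ Z := tsum_nonneg fun m ↦ by positivity
    have hZle : Z ≤ 9 / ε' := by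
      have h := tsum_succ_rpow_neg_sub_one_le (δ := 2 * r) (by positivity)
      have e : ∀ m : ℕ, ((m + 1 : ℕ) : ℝ) ^ (-(2 * r) - 1) = ((m + 1 : ℕ) : ℝ) ^ (-(1 + 2 * r)) := by
        intro m; congr 1; ring
      rw [tsum_congr e] at h
      have h1ε : (1 : ℝ) ≤ 1 / ε' := one_le_one_div hε'0 hε'1
      have h8 : 1 / (2 * r) = 8 * (1 / ε') := by rw [hrdef]; field_simp; ring
      have : 1 + 1 / (2 * r) ≤ 9 / ε' := by
        rw [h8, show (9 : ℝ) / ε' = 9 * (1 / ε') by ring]; linarith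
      exact h.trans this
    have hq4r : (q : ℝ) ^ (4 * r) = (q : ℝ) ^ (ε' / 4) := by
      rw [show 4 * r = ε' / 4 by rw [hrdef]; ring]
    have hdq : 0 < (q : ℝ) ^ (ε' / 4) := Real.rpow_pos_of_pos hq0 _
    have hβ' : 0 < 1 - β := by linarith
    have hL1 : ‖χ.LFunction 1‖ ≤ (1 - β) * (288 * (q : ℝ) ^ (ε' / 4) / ε' ^ 2) := by
      calc ‖χ.LFunction 1‖ ≤ (1 - β) * (2 * (q : ℝ) ^ (4 * r) * Z / r) := hmv
        _ ≤ (1 - β) * (2 * (q : ℝ) ^ (4 * r) * (9 / ε') / r) := by gcongr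
        _ = (1 - β) * (288 * (q : ℝ) ^ (ε' / 4) / ε' ^ 2) := by
            rw [hq4r, hrdef]; field_simp; ring
    -- `CT ε'³ q^{-ε'} ≤ Re L(1,χ) ≤ ‖L(1,χ)‖ ≤ (1-β)·288 q^{ε'/4}/ε'²`
    have hchain : CT * ε' ^ 3 * (q : ℝ) ^ (-ε') ≤ (1 - β) * (288 * (q : ℝ) ^ (ε' / 4) / ε' ^ 2) :=
      (hL.trans (Complex.re_le_norm _)).trans hL1
    -- multiply by `ε'²/(288 q^{ε'/4})`: `CT ε'^5/288 · q^{-ε'} q^{-ε'/4} ≤ 1 - β`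
    have hpow : (q : ℝ) ^ (-ε') * ((q : ℝ) ^ (ε' / 4))⁻¹ = (q : ℝ) ^ (-ε) := by
      rw [← Real.rpow_neg hq0.le, ← Real.rpow_add hq0]; congr 1; rw [hε'def]; ring
    have hstep : CT * ε' ^ 5 / 288 * (q : ℝ) ^ (-ε) ≤ 1 - β := by
      have h := mul_le_mul_of_nonneg_right hchain
        (by positivity : (0 : ℝ) ≤ ε' ^ 2 / (288 * (q : ℝ) ^ (ε' / 4)))
      have lhs : CT * ε' ^ 3 * (q : ℝ) ^ (-ε') * (ε' ^ 2 / (288 * (q : ℝ) ^ (ε' / 4))) =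
          CT * ε' ^ 5 / 288 * ((q : ℝ) ^ (-ε') * ((q : ℝ) ^ (ε' / 4))⁻¹) := by
        field_simp
      have rhs : (1 - β) * (288 * (q : ℝ) ^ (ε' / 4) / ε' ^ 2) *
          (ε' ^ 2 / (288 * (q : ℝ) ^ (ε' / 4))) = 1 - β := by
        field_simp
      rw [lhs, rhs, hpow] at h
      exact h
    -- `CT ε⁵/1000 ≤ CT ε'^5/288`
    have hcmp : CT * ε ^ 5 / 1000 ≤ CT * ε' ^ 5 / 288 := by
      rw [hε'def, show CT * (4 * ε / 5) ^ 5 / 288 = CT * ε ^ 5 * (1024 / 900000) by ring,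
        show CT * ε ^ 5 / 1000 = CT * ε ^ 5 * (1 / 1000) by ring]
      exact mul_le_mul_of_nonneg_left (by norm_num) (by positivity)
    calc CT * ε ^ 5 / 1000 * (q : ℝ) ^ (-ε) ≤ CT * ε' ^ 5 / 288 * (q : ℝ) ^ (-ε) :=
          mul_le_mul_of_nonneg_right hcmp hqε0.le
      _ ≤ 1 - β := hstep

/-- **Tatuzawa's form of MV Cor. 11.15: explicit zero repulsion with at most ONE exceptional modulus.**
For `0 < ε ≤ 1` there is `q₀ = q₀(ε) ∈ ℕ` such that for every `q ≠ q₀`, every primitive quadratic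
non-principal `χ mod q` and every real zero `β` of `L(s, χ)`:
`(C_T ε⁵/1000)·q^{-ε} ≤ 1 − β`, `C_T = c_E/(2592 B)` explicit.
[cite: Tatuzawa1951, Theorem 2] [cite: MontgomeryVaughan2007, §11.2 Corollary 11.15 and Exercise 6 (i)] -/
theorem tatuzawa_realZero_atMostOne_modulus {ε : ℝ} (hε : 0 < ε) (hε1 : ε ≤ 1) :
    ∃ q₀ : ℕ, ∀ (q : ℕ) [NeZero q] (χ : DirichletCharacter ℂ q), χ ^ 2 = 1 → χ.IsPrimitive →
      χ ≠ 1 → q ≠ q₀ → ∀ β : ℝ, χ.LFunction β = 0 →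
        estermannC / (2592 * ballConst) * ε ^ 5 / 1000 * (q : ℝ) ^ (-ε) ≤ 1 - β := by
  have hε' : 0 < 4 * ε / 5 := by positivity
  have hε'1 : 4 * ε / 5 ≤ 1 := by linarith
  obtain ⟨q₀, hq₀⟩ := tatuzawa_atMostOne_modulus hε' hε'1
  exact ⟨q₀, fun q _ χ hq hχp hχ hne β hzero ↦
    one_sub_realZero_ge_of_LFunction_one_ge hε hε1 χ hχ (hq₀ q χ hq hχp hχ hne) hzero⟩

/-- **Two characters of different moduli: at least one has no close real zero** (explicit): for
`0 < ε ≤ 1` and primitive quadratic non-principal `χ₁ mod q₁`, `χ₂ mod q₂` with `q₁ ≠ q₂`, either every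
real zero `β` of `L(s,χ₁)` has `(C_T ε⁵/1000) q₁^{-ε} ≤ 1 − β`, or every real zero of `L(s,χ₂)` has
`(C_T ε⁵/1000) q₂^{-ε} ≤ 1 − β`. [cite: Tatuzawa1951, Theorem 2]
[cite: MontgomeryVaughan2007, §11.2 Corollary 11.15 and Exercise 6 (i)] -/
theorem tatuzawa_realZero_of_ne {ε : ℝ} (hε : 0 < ε) (hε1 : ε ≤ 1) {q₁ q₂ : ℕ} [NeZero q₁] [NeZero q₂]
    (χ₁ : DirichletCharacter ℂ q₁) (hχ₁ : χ₁ ≠ 1) (hq₁ : χ₁ ^ 2 = 1) (hχ₁p : χ₁.IsPrimitive)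
    (χ₂ : DirichletCharacter ℂ q₂) (hχ₂ : χ₂ ≠ 1) (hq₂ : χ₂ ^ 2 = 1) (hχ₂p : χ₂.IsPrimitive)
    (hne : q₁ ≠ q₂) :
    (∀ β : ℝ, χ₁.LFunction β = 0 →
        estermannC / (2592 * ballConst) * ε ^ 5 / 1000 * (q₁ : ℝ) ^ (-ε) ≤ 1 - β) ∨
      (∀ β : ℝ, χ₂.LFunction β = 0 →
        estermannC / (2592 * ballConst) * ε ^ 5 / 1000 * (q₂ : ℝ) ^ (-ε) ≤ 1 - β) := by
  have hε' : 0 < 4 * ε / 5 := by positivity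
  have hε'1 : 4 * ε / 5 ≤ 1 := by linarith
  rcases tatuzawa_of_ne hε' hε'1 χ₁ hχ₁ hq₁ hχ₁p χ₂ hχ₂ hq₂ hχ₂p hne with h | h
  · exact Or.inl fun β hz ↦ one_sub_realZero_ge_of_LFunction_one_ge hε hε1 χ₁ hχ₁ h hz
  · exact Or.inr fun β hz ↦ one_sub_realZero_ge_of_LFunction_one_ge hε hε1 χ₂ hχ₂ h hz

end Literature.NumberTheory.LFunctions.Siegel

end
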